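import Literature.IUT.HodgeArakelov.BadPrimeGaussianMonoidsGenuineRecordRestrictionIsoPair
import Literature.IUT.HodgeArakelov.BadPrimeGaussianMonoidsCor36GenuineRecordThirdDisplay

/-!
# [IUTchII] Cor 3.6 (ii), third display `Ψ_{†F^Θ_v,α} ⥲ Ψ^ι_env(M^Θ_*) ⥲ Ψ_ξ(M^Θ_*) ⥲ Ψ_{Fξ}(†F_v)` END-TO-END at the genuine `θ_env`
# data over `ℚ̄_pˣ` for the pointed-inversion PAIR family — abc-iut-w5-d192's composite (p436899) with its last [IUTchII]-internal
# binder `horb` DISCHARGED by abc-iut-w4-d004's `horb_toRecord_pairRhoLim` (proof-only)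

S. Mochizuki, *Inter-universal Teichmüller theory II*, kurims Dec-2020 manuscript, Cor 3.6 (ii) p. 100 l. 26–60 (third display), Cor 3.5 (ii)
p. 95, Prop 2.2 (ii) p. 66 [cite: Mochizuki2012, Cor 3.6 (ii) p.100]. Claim key DISPUTED (D-0012); nothing disputed is asserted here.
PROOF-ONLY companion (abc-iut cell, layer L6, seat abc-iut-w4-d004 gen 4; node **IUTchII:Cor3.6(ii)**, sub-DAG row Cor-36.ii.r10; sequel BY
NAME «COR36-r10-HORB» of abc-iut-w5-d192's row COR36-r10-GENUINE-OF-EVALUATION, that lineage having closed NO-RESEAT 10:46Z). NO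
definition, NO `Prop` fact, NO instance; the two theorems are abc-iut-w5-d192's `exists_kummerRestrictionTransportIso'_toRecord_padic_of_evaluation(_self)`
VERBATIM with the binder `horb` replaced by the inputs of `horb_toRecord_pairRhoLim` (file 1 of row «COR35ii-HORB-GENUINE»): (R1) the
pointed-inversion pair `(αι, βι)` with `toLZ (αι γ) = −1` whose limit action IS the inversion at the label `K.label α` of the Frobenioid-side
datum (`hi₀`), (R2)(R3) the class-level [EtTh] Prop 1.4 statements `hsign`/`hroot`/`hfree`, `hker`, `μ ⊆ O`.
* **`exists_kummerRestrictionTransportIso'_toRecord_padic_of_evaluation_pairRhoLim`** — for ANY `†F^Θ_v`-side Kummer datum `K`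
  (Prop 3.3 (i)) and ANY Kummer copy `e : N ⥲ κ₀(O)`, the composite `Ψ_{†F^Θ_v,α} ⥲ Ψ_{Fξ}(†F_v)` exists, pinned to «restriction ∘ Kummer»;
* **`exists_kummerRestrictionTransportIso'_toRecord_padic_of_evaluation_self_pairRhoLim`** — the same with `(Ψ_{†C_v})` read as `O` and
  the Kummer copy = `κ₀` onto its image.
RESIDUAL of row Cor-36.ii.r10 after this file = DATA only: the `†F^Θ_v`-side datum `K`, the [EtTh] §1 evaluation/presentation/VALUE data,
the model data, and the [IUTchII] Prop 2.2 (ii) model residual (R1)(R2)(R3) + `hker` + `μ ⊆ O` (files 4/5 of row «COR35ii-HORB-GENUINE»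
push (R1)/`hker`/(R2)(R3) further to the [EtTh] inversion datum, the cyclotome tower and the `Δ_Θ`-class-level statements). HONEST
FRAMING: composition of landed theorems; no side taken on [IUTchIII] Cor 3.12; typed ≠ proved ≠ endorsed.
-/

noncomputable section

namespace Literature.IUT.HodgeArakelov

namespace EtaleLevels

open Literature.AnabelianGeometry.EtaleTheta CohomologySystemOfContH1 EtaleThetaDataOfSetting TemperedThetaMonoids
  BadPrimeGaussianMonoids

variable {p : ℕ} [Fact p.Prime] {D : Literature.AnabelianGeometry.EtaleTheta.ThetaSetting p}
  {E : D.EtaleThetaData} {l : ℕ} (C : E.DoubleUnderline l) (hC : D.Compat) (hS : D.Sec2Hyps)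
  (hl : l.Prime) (hp2 : p ≠ 2) (hpl : p ≠ l) (hζ : ∃ ζ : D.K, IsPrimitiveRoot ζ (4 * l))
  (mods : ∀ M : ℕ+, D.CyclotomeMod l M)
  (f : contCocycles D.toTheta D.DeltaTheta C.GtpYdduu) (hf : f ∈ C.rootCocycles hC)
  (hmods : ∀ (M M' : ℕ+) (h : (M : ℕ) ∣ (M' : ℕ)) (x : D.lDeltaTheta l),
    MuN.red p M M' h ((mods M').red x) = (mods M).red x)
  (h15 : Literature.AnabelianGeometry.EtaleTheta.ThetaSetting.Prop15iii E hC) (L : C.CuspLabels)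
  (hZ : ∀ M : ℕ+, Nonempty (ModelCyclotomes.lDeltaQuot (C.rigidData (mods M) hC hS h15 L) ≃*
    Literature.IUT.HodgeTheaters.ZHat))
  (hcharY : EtaleThetaDataOfSetting.PiYddCharacteristic C)
  (hlim : Function.Bijective (rigidLimHom C hC hS hl hp2 hpl hζ mods f hf hmods h15 L hZ))
  [(EtaleThetaDataOfSetting.PiYdd C).Normal]
  {Iota : Type}
  (iota : Iota → ((thetaEnvData C hC hS hl hp2 hpl hζ mods f hf hmods h15 L hZ hcharY hlim).D.coh.lim ≃+
    (thetaEnvData C hC hS hl hp2 hpl hζ mods f hf hmods h15 L hZ hcharY hlim).D.coh.lim))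
  {Lbl : Type*} {P₀ : TopGroup.{0}} (φ₀ : P₀ →* D.GtpTheta) (s : Lbl → (P₀ →* Pi C))
  (hι : ∀ t, Continuous ((MonoidHom.id (Pi C)).comp (s t)))
  (hN : ∀ t, (⊤ : Subgroup P₀).map ((MonoidHom.id (Pi C)).comp (s t)) ≤ PiYdd C)
  (hφ : ∀ t, (phi C).comp ((MonoidHom.id (Pi C)).comp (s t)) = φ₀)


section Padic

variable [TopologicalSpace (PadicAlgCl p)ˣ]
  (c : CyclotomeCoefficients (phi C) (D.lDeltaTheta l) (PadicAlgCl p)ˣ)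
  (hA : ∀ b : (PadicAlgCl p)ˣ, IsOpen (MulAction.stabilizer (Pi C) b : Set (Pi C)))
  (hfi : ∀ b : (PadicAlgCl p)ˣ, (MulAction.stabilizer (Pi C) b).FiniteIndex)
  (O : Submonoid (PadicAlgCl p)ˣ)
  [MulDistribMulAction P₀ (PadicAlgCl p)ˣ]
  (c₀ : CyclotomeCoefficients φ₀ (D.lDeltaTheta l) (PadicAlgCl p)ˣ)
  (hA₀ : ∀ b : (PadicAlgCl p)ˣ, IsOpen (MulAction.stabilizer P₀ b : Set P₀))
  (hfi₀ : ∀ b : (PadicAlgCl p)ˣ, (MulAction.stabilizer P₀ b).FiniteIndex)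
  -- the module of FUNCTIONS with its Kummer data over `Π^tp_{Ÿ̲̲}` (abc-iut-w4-d004 …RestrictionIsoOfEvaluation)
  {Afun : Type} [CommGroup Afun] [MulDistribMulAction (Pi C) Afun] [TopologicalSpace Afun] [RootableBy Afun ℕ]
  (cf : CyclotomeCoefficients (phi C) (D.lDeltaTheta l) Afun)
  (hAf : ∀ a : Afun, IsOpen (MulAction.stabilizer (Pi C) a : Set (Pi C)))
  (hfif : ∀ a : Afun, (MulAction.stabilizer (Pi C) a).FiniteIndex)


/-- **WITH `horb` DISCHARGED for the pointed-inversion pair family (`iota (K.label α) = pairRhoLim C αι βι …`).** **[Cor-36.ii.r10] `Ψ_{†F^Θ_v,α} ⥲ Ψ^ι_env(𝕄_*) ⥲ Ψ_ξ(𝕄_*) ⥲ Ψ_{Fξ}(†F_v)` END-TO-END AT THE GENUINE `θ_env` DATA over `ℚ̄_pˣ`**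
([IUTchII] Cor 3.6 (ii) third display, p. 100 l. 26–60), any inversion family `iota`: for ANY `†F^Θ_v`-side Kummer datum `K`
(Prop 3.3 (i), abc-iut-L6-t2's `Prop33KummerStatements.kummerTheta`) over the genuine record and ANY Kummer copy `e : N ⥲ κ₀(O)` of
the labeled constants (Cor 3.6 (i)), the COMPOSITE `Φ : Ψ_{†F^Θ_v,α} ⥲ Ψ_{Fξ}(†F_v)` exists, pinned: `piIso e ∘ Φ = restriction ∘
kummerTheta`. The restriction isomorphism is abc-iut-w4-d004's `exists_unique_restrictionIso'_toRecord_padic_of_evaluation` —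
(K), (R), (E), `hU`, `hUsurj`, `hinj`, `hq₀` ALL DERIVED from: the evaluation sections, the model data, a module of functions with
Kummer data and evaluations equivariant along the sections, the presentation `θ = κ_fun(fΘ)` and the values `ev_t fΘ = q_t ∈ O`
(`q_{t₀}` non-unit), `θ ∈ θ^{label α}_env(𝕄_*)`, `horb`. [cite: Mochizuki2012, Cor 3.6 (ii) p.100] -/
theorem exists_kummerRestrictionTransportIso'_toRecord_padic_of_evaluation_pairRhoLim (hc : Function.Bijective c.hom)
    -- `μ ⊆ O` (with inverses)
    (hOtors : ∀ a : (PadicAlgCl p)ˣ, IsOfFinOrder a → a ∈ O ∧ a⁻¹ ∈ O)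
    -- (R1) the pointed-inversion PAIR, reversing the `ℤ`-torsor
    (αι : (Pi C) ≃ₜ* (Pi C)) (βι : D.GtpTheta ≃ₜ* D.GtpTheta) (hφαβ : ∀ g, βι (phi C g) = phi C (αι g))
    (hAβ : ∀ a : D.GtpTheta, a ∈ D.lDeltaTheta l ↔ βι a ∈ D.lDeltaTheta l)
    (hH : ∀ x, x ∈ PiYdd C ↔ αι x ∈ PiYdd C)
    (γ ε : Pi C) (hγ : C.toLZ γ = Multiplicative.ofAdd 1) (hε₁ : (ε : D.PiTemp) ∈ D.GtpY)
    (hε₂ : (ε : D.PiTemp) ∉ D.GtpYdd) (hαγ : C.toLZ (αι γ) = Multiplicative.ofAdd (-1))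
    -- (R2)(R3) [EtTh] Prop 1.4 at the class level
    (hsign : ∃ κ : ContH1 (phi C) (D.lDeltaTheta l) (PiYdd C ⊓ ⊤), κ ^ 2 = 1 ∧
      ContH1.conj (phi C) (D.lDeltaTheta l) ε (rootLiftClass C) = rootLiftClass C * κ)
    (hroot : ∃ τ₀ : Pi C, (τ₀ : D.PiTemp) ∈ D.GtpY ∧
      h1TopAut (phi C) (D.lDeltaTheta l) (PiYdd C) αι βι hφαβ (fun a ha => (hAβ a).mp ha) hH (rootLiftClass C) =
        ContH1.conj (phi C) (D.lDeltaTheta l) τ₀ (rootLiftClass C))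
    (hfree : ∀ m n : ℤ, IsOfFinAddOrder
      ((h1Top C).symm (Additive.ofMul (ContH1.conj (phi C) (D.lDeltaTheta l) (γ ^ m) (rootLiftClass C))) -
        (h1Top C).symm (Additive.ofMul (ContH1.conj (phi C) (D.lDeltaTheta l) (γ ^ n) (rootLiftClass C)))) →
      m = n)
    (hker : ∀ y : (coh C).H1 ⊤, (coh C).toLim ⊤ y = 0 → IsOfFinAddOrder y)
    (hc₀ : Function.Bijective c₀.hom) (hc₀c : ∀ ζ, c₀.hom ζ = c.hom ζ)
    (hact : ∀ (t : Lbl) (g : P₀) (a : (PadicAlgCl p)ˣ), g • a = s t g • a) (t₁ : Lbl)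
    [((EtaleThetaDataOfSetting.aug C).comp (s t₁)).range.FiniteIndex]
    {F : TemperedFrobenioidThetaData.{0, 0} (modelSystem C hC hS hl hp2 hpl hζ mods f hf hmods h15 L hZ).PiX}
    (K : Prop33KummerStatements
      ((thetaEnvData C hC hS hl hp2 hpl hζ mods f hf hmods h15 L hZ hcharY hlim).toRecord
          (h1LimConjMulAut (phi C) (D.lDeltaTheta l) (PiYdd C))
          (h1LimKummerOn (phi C) (D.lDeltaTheta l) (PiYdd C) c hA hfi O) iota) F)
    (α : (modelSystem C hC hS hl hp2 hpl hζ mods f hf hmods h15 L hZ).PiX)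
    {θ : ((thetaEnvData C hC hS hl hp2 hpl hζ mods f hf hmods h15 L hZ hcharY hlim).toRecord
          (h1LimConjMulAut (phi C) (D.lDeltaTheta l) (PiYdd C))
          (h1LimKummerOn (phi C) (D.lDeltaTheta l) (PiYdd C) c hA hfi O) iota).H}
    (hθ : θ ∈ ((thetaEnvData C hC hS hl hp2 hpl hζ mods f hf hmods h15 L hZ hcharY hlim).toRecord
          (h1LimConjMulAut (phi C) (D.lDeltaTheta l) (PiYdd C))
          (h1LimKummerOn (phi C) (D.lDeltaTheta l) (PiYdd C) c hA hfi O) iota).thetaEnv (K.label α))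
    (hi₀ : iota (K.label α) = pairRhoLim C αι βι hφαβ hAβ hH)
    (R : Lbl → (((thetaEnvData C hC hS hl hp2 hpl hζ mods f hf hmods h15 L hZ hcharY hlim).toRecord
          (h1LimConjMulAut (phi C) (D.lDeltaTheta l) (PiYdd C))
          (h1LimKummerOn (phi C) (D.lDeltaTheta l) (PiYdd C) c hA hfi O) iota).H →*
      Multiplicative (h1Lim φ₀ (D.lDeltaTheta l) (⊤ : Subgroup P₀) ⊥)))
    (hR : ∀ t y, Multiplicative.toAdd (R t y) =
      h1LimCongr (D.lDeltaTheta l) ⊤ (hφ t) ⊥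
        (h1LimComap (phi C) (D.lDeltaTheta l) ((MonoidHom.id (Pi C)).comp (s t)) (hι t) (hN t)
          (AddEquiv.additiveMultiplicative (h1Lim (phi C) (D.lDeltaTheta l) (PiYdd C) ⊥) (Additive.ofMul y))))
    (ev : Lbl → (Afun →* (PadicAlgCl p)ˣ)) (hev : ∀ (t : Lbl) (g : P₀) (a : Afun), ev t (s t g • a) = g • ev t a)
    (hcev : ∀ (t : Lbl) (ζ : cyclotome Afun), c₀.hom (cyclotome.map (ev t) ζ) = cf.hom ζ)
    {fΘ : Afun}
    (hθf : AddEquiv.additiveMultiplicative (h1Lim (phi C) (D.lDeltaTheta l) (PiYdd C) ⊥) (Additive.ofMul θ) =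
      Multiplicative.toAdd (h1LimKummer (phi C) (D.lDeltaTheta l) (PiYdd C) cf hAf hfif fΘ))
    (q : Lbl → O) (hval : ∀ t, ev t fΘ = (q t : (PadicAlgCl p)ˣ)) (t₀ : Lbl) (hq : ¬ IsUnit (q t₀))
    {N : Type*} [CommMonoid N] (e : N ≃* MonoidHom.mrange (h1LimKummerOn φ₀ (D.lDeltaTheta l) ⊤ c₀ hA₀ hfi₀ O)) :
    ∃ Φ : F.frobThetaMonoid α ≃*
        frobenioidGaussianMonoid e (fun t =>
          (fun t =>
          ((R t).comp (((thetaEnvData C hC hS hl hp2 hpl hζ mods f hf hmods h15 L hZ hcharY hlim).toRecord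
          (h1LimConjMulAut (phi C) (D.lDeltaTheta l) (PiYdd C))
          (h1LimKummerOn (phi C) (D.lDeltaTheta l) (PiYdd C) c hA hfi O) iota).thetaMonoid (K.label α)).subtype).codRestrict
            (MonoidHom.mrange (h1LimKummerOn φ₀ (D.lDeltaTheta l) ⊤ c₀ hA₀ hfi₀ O))
            (restriction_mem_mrange_gen
              ((thetaEnvData C hC hS hl hp2 hpl hζ mods f hf hmods h15 L hZ hcharY hlim).toRecord
          (h1LimConjMulAut (phi C) (D.lDeltaTheta l) (PiYdd C))
          (h1LimKummerOn (phi C) (D.lDeltaTheta l) (PiYdd C) c hA hfi O) iota)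
              (h1LimKummerOn (phi C) (D.lDeltaTheta l) (PiYdd C) c hA hfi O)
              (h1LimKummerOn φ₀ (D.lDeltaTheta l) ⊤ c₀ hA₀ hfi₀ O)
              (fun t => (R t).comp (((thetaEnvData C hC hS hl hp2 hpl hζ mods f hf hmods h15 L hZ hcharY hlim).toRecord
          (h1LimConjMulAut (phi C) (D.lDeltaTheta l) (PiYdd C))
          (h1LimKummerOn (phi C) (D.lDeltaTheta l) (PiYdd C) c hA hfi O) iota).thetaMonoid (K.label α)).subtype)
              q (hκ_padic C c hA hfi O hc) (ThetaEnvData.toRecord_constantMonoid _ _ _ _) hθ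
              (horb_toRecord_pairRhoLim C hC hS hl hp2 hpl hζ mods f hf hmods h15 L hZ hcharY hlim
                iota c hA hfi O hc hOtors αι βι hφαβ hAβ hH γ ε hγ hε₁ hε₂ hαγ hsign hroot hfree hker hi₀ hθ)
              (fun t m hm => hRκ_toRecord C hC hS hl hp2 hpl hζ mods f hf hmods h15 L hZ hcharY hlim iota φ₀ s hι hN hφ c
                hA hfi O c₀ hA₀ hfi₀ hc₀c hact R hR t m hm)
              (fun t => hRθ_toRecord_of_evaluation C hC hS hl hp2 hpl hζ mods f hf hmods h15 L hZ hcharY hlim iota φ₀ s hι hN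
                hφ c hA hfi O c₀ hA₀ hfi₀ cf hAf hfif R hR ev hev hcev hθf q hval t) t)) t
            ⟨θ, thetaEnv_subset_thetaMonoid
              ((thetaEnvData C hC hS hl hp2 hpl hζ mods f hf hmods h15 L hZ hcharY hlim).toRecord
          (h1LimConjMulAut (phi C) (D.lDeltaTheta l) (PiYdd C))
          (h1LimKummerOn (phi C) (D.lDeltaTheta l) (PiYdd C) c hA hfi O) iota) (K.label α) hθ⟩),
      ∀ x, piIso Lbl e ((Φ x : frobenioidGaussianMonoid e _) : Lbl → N) =
        MonoidHom.pi
          (fun t =>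
          ((R t).comp (((thetaEnvData C hC hS hl hp2 hpl hζ mods f hf hmods h15 L hZ hcharY hlim).toRecord
          (h1LimConjMulAut (phi C) (D.lDeltaTheta l) (PiYdd C))
          (h1LimKummerOn (phi C) (D.lDeltaTheta l) (PiYdd C) c hA hfi O) iota).thetaMonoid (K.label α)).subtype).codRestrict
            (MonoidHom.mrange (h1LimKummerOn φ₀ (D.lDeltaTheta l) ⊤ c₀ hA₀ hfi₀ O))
            (restriction_mem_mrange_gen
              ((thetaEnvData C hC hS hl hp2 hpl hζ mods f hf hmods h15 L hZ hcharY hlim).toRecord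
          (h1LimConjMulAut (phi C) (D.lDeltaTheta l) (PiYdd C))
          (h1LimKummerOn (phi C) (D.lDeltaTheta l) (PiYdd C) c hA hfi O) iota)
              (h1LimKummerOn (phi C) (D.lDeltaTheta l) (PiYdd C) c hA hfi O)
              (h1LimKummerOn φ₀ (D.lDeltaTheta l) ⊤ c₀ hA₀ hfi₀ O)
              (fun t => (R t).comp (((thetaEnvData C hC hS hl hp2 hpl hζ mods f hf hmods h15 L hZ hcharY hlim).toRecord
          (h1LimConjMulAut (phi C) (D.lDeltaTheta l) (PiYdd C))
          (h1LimKummerOn (phi C) (D.lDeltaTheta l) (PiYdd C) c hA hfi O) iota).thetaMonoid (K.label α)).subtype)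
              q (hκ_padic C c hA hfi O hc) (ThetaEnvData.toRecord_constantMonoid _ _ _ _) hθ
              (horb_toRecord_pairRhoLim C hC hS hl hp2 hpl hζ mods f hf hmods h15 L hZ hcharY hlim
                iota c hA hfi O hc hOtors αι βι hφαβ hAβ hH γ ε hγ hε₁ hε₂ hαγ hsign hroot hfree hker hi₀ hθ)
              (fun t m hm => hRκ_toRecord C hC hS hl hp2 hpl hζ mods f hf hmods h15 L hZ hcharY hlim iota φ₀ s hι hN hφ c
                hA hfi O c₀ hA₀ hfi₀ hc₀c hact R hR t m hm)
              (fun t => hRθ_toRecord_of_evaluation C hC hS hl hp2 hpl hζ mods f hf hmods h15 L hZ hcharY hlim iota φ₀ s hι hN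
                hφ c hA hfi O c₀ hA₀ hfi₀ cf hAf hfif R hR ev hev hcev hθf q hval t) t))
          (K.kummerTheta α x) := by
  obtain ⟨eΨ, heΨ, -⟩ :=
    exists_unique_restrictionIso'_toRecord_padic_of_evaluation_pairRhoLim C hC hS hl hp2 hpl hζ mods f hf hmods h15 L hZ hcharY
      hlim iota φ₀ s hι hN hφ c hA hfi O c₀ hA₀ hfi₀ cf hAf hfif hc hOtors αι βι hφαβ hAβ hH γ ε hγ hε₁ hε₂ hαγ hsign hroot hfree
      hker hc₀ hc₀c hact t₁ hi₀ hθ R hR ev hev hcev hθf q hval t₀ hq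
  exact exists_kummerRestrictionTransportIso' K α _ eΨ heΨ e

/-- **WITH `horb` DISCHARGED (pair family).** **The same with the Frobenioid-side constant monoid `(Ψ_{†C_v})` READ AS `O` itself** and the Kummer copy = the `G_v`-level
Kummer map `κ₀ : O → lim H¹(Π₀ ∩ ·, l·Δ_Θ)_{φ₀}` onto its image — injective by abc-iut-w4-d004's `hκ₀_padic` (abc-iut-w4-d007's
Kummer injectivity over a section with finite-index `ε`-image); the identification of `Ψ_{†C_v}` with `𝒪^▷` is J5 of
SUBDAG-IUTchII-Prop-31-33-34 for the genuine `†F_v` (Cor 3.6 (i) p. 99 l. 44–47 «`(Ψ_{†C_v})_t ⥲ Ψ_cns(M^Θ_*)_t`»).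
[cite: Mochizuki2012, Cor 3.6 (ii) p.100] -/
theorem exists_kummerRestrictionTransportIso'_toRecord_padic_of_evaluation_self_pairRhoLim (hc : Function.Bijective c.hom)
    -- `μ ⊆ O` (with inverses)
    (hOtors : ∀ a : (PadicAlgCl p)ˣ, IsOfFinOrder a → a ∈ O ∧ a⁻¹ ∈ O)
    -- (R1) the pointed-inversion PAIR, reversing the `ℤ`-torsor
    (αι : (Pi C) ≃ₜ* (Pi C)) (βι : D.GtpTheta ≃ₜ* D.GtpTheta) (hφαβ : ∀ g, βι (phi C g) = phi C (αι g))
    (hAβ : ∀ a : D.GtpTheta, a ∈ D.lDeltaTheta l ↔ βι a ∈ D.lDeltaTheta l)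
    (hH : ∀ x, x ∈ PiYdd C ↔ αι x ∈ PiYdd C)
    (γ ε : Pi C) (hγ : C.toLZ γ = Multiplicative.ofAdd 1) (hε₁ : (ε : D.PiTemp) ∈ D.GtpY)
    (hε₂ : (ε : D.PiTemp) ∉ D.GtpYdd) (hαγ : C.toLZ (αι γ) = Multiplicative.ofAdd (-1))
    -- (R2)(R3) [EtTh] Prop 1.4 at the class level
    (hsign : ∃ κ : ContH1 (phi C) (D.lDeltaTheta l) (PiYdd C ⊓ ⊤), κ ^ 2 = 1 ∧
      ContH1.conj (phi C) (D.lDeltaTheta l) ε (rootLiftClass C) = rootLiftClass C * κ)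
    (hroot : ∃ τ₀ : Pi C, (τ₀ : D.PiTemp) ∈ D.GtpY ∧
      h1TopAut (phi C) (D.lDeltaTheta l) (PiYdd C) αι βι hφαβ (fun a ha => (hAβ a).mp ha) hH (rootLiftClass C) =
        ContH1.conj (phi C) (D.lDeltaTheta l) τ₀ (rootLiftClass C))
    (hfree : ∀ m n : ℤ, IsOfFinAddOrder
      ((h1Top C).symm (Additive.ofMul (ContH1.conj (phi C) (D.lDeltaTheta l) (γ ^ m) (rootLiftClass C))) -
        (h1Top C).symm (Additive.ofMul (ContH1.conj (phi C) (D.lDeltaTheta l) (γ ^ n) (rootLiftClass C)))) →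
      m = n)
    (hker : ∀ y : (coh C).H1 ⊤, (coh C).toLim ⊤ y = 0 → IsOfFinAddOrder y)
    (hc₀ : Function.Bijective c₀.hom) (hc₀c : ∀ ζ, c₀.hom ζ = c.hom ζ)
    (hact : ∀ (t : Lbl) (g : P₀) (a : (PadicAlgCl p)ˣ), g • a = s t g • a) (t₁ : Lbl)
    [((EtaleThetaDataOfSetting.aug C).comp (s t₁)).range.FiniteIndex]
    {F : TemperedFrobenioidThetaData.{0, 0} (modelSystem C hC hS hl hp2 hpl hζ mods f hf hmods h15 L hZ).PiX}
    (K : Prop33KummerStatements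
      ((thetaEnvData C hC hS hl hp2 hpl hζ mods f hf hmods h15 L hZ hcharY hlim).toRecord
          (h1LimConjMulAut (phi C) (D.lDeltaTheta l) (PiYdd C))
          (h1LimKummerOn (phi C) (D.lDeltaTheta l) (PiYdd C) c hA hfi O) iota) F)
    (α : (modelSystem C hC hS hl hp2 hpl hζ mods f hf hmods h15 L hZ).PiX)
    {θ : ((thetaEnvData C hC hS hl hp2 hpl hζ mods f hf hmods h15 L hZ hcharY hlim).toRecord
          (h1LimConjMulAut (phi C) (D.lDeltaTheta l) (PiYdd C))
          (h1LimKummerOn (phi C) (D.lDeltaTheta l) (PiYdd C) c hA hfi O) iota).H}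
    (hθ : θ ∈ ((thetaEnvData C hC hS hl hp2 hpl hζ mods f hf hmods h15 L hZ hcharY hlim).toRecord
          (h1LimConjMulAut (phi C) (D.lDeltaTheta l) (PiYdd C))
          (h1LimKummerOn (phi C) (D.lDeltaTheta l) (PiYdd C) c hA hfi O) iota).thetaEnv (K.label α))
    (hi₀ : iota (K.label α) = pairRhoLim C αι βι hφαβ hAβ hH)
    (R : Lbl → (((thetaEnvData C hC hS hl hp2 hpl hζ mods f hf hmods h15 L hZ hcharY hlim).toRecord
          (h1LimConjMulAut (phi C) (D.lDeltaTheta l) (PiYdd C))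
          (h1LimKummerOn (phi C) (D.lDeltaTheta l) (PiYdd C) c hA hfi O) iota).H →*
      Multiplicative (h1Lim φ₀ (D.lDeltaTheta l) (⊤ : Subgroup P₀) ⊥)))
    (hR : ∀ t y, Multiplicative.toAdd (R t y) =
      h1LimCongr (D.lDeltaTheta l) ⊤ (hφ t) ⊥
        (h1LimComap (phi C) (D.lDeltaTheta l) ((MonoidHom.id (Pi C)).comp (s t)) (hι t) (hN t)
          (AddEquiv.additiveMultiplicative (h1Lim (phi C) (D.lDeltaTheta l) (PiYdd C) ⊥) (Additive.ofMul y))))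
    (ev : Lbl → (Afun →* (PadicAlgCl p)ˣ)) (hev : ∀ (t : Lbl) (g : P₀) (a : Afun), ev t (s t g • a) = g • ev t a)
    (hcev : ∀ (t : Lbl) (ζ : cyclotome Afun), c₀.hom (cyclotome.map (ev t) ζ) = cf.hom ζ)
    {fΘ : Afun}
    (hθf : AddEquiv.additiveMultiplicative (h1Lim (phi C) (D.lDeltaTheta l) (PiYdd C) ⊥) (Additive.ofMul θ) =
      Multiplicative.toAdd (h1LimKummer (phi C) (D.lDeltaTheta l) (PiYdd C) cf hAf hfif fΘ))
    (q : Lbl → O) (hval : ∀ t, ev t fΘ = (q t : (PadicAlgCl p)ˣ)) (t₀ : Lbl) (hq : ¬ IsUnit (q t₀)) :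
    ∃ (e : O ≃* MonoidHom.mrange (h1LimKummerOn φ₀ (D.lDeltaTheta l) ⊤ c₀ hA₀ hfi₀ O))
      (Φ : F.frobThetaMonoid α ≃*
        frobenioidGaussianMonoid e (fun t =>
          (fun t =>
          ((R t).comp (((thetaEnvData C hC hS hl hp2 hpl hζ mods f hf hmods h15 L hZ hcharY hlim).toRecord
          (h1LimConjMulAut (phi C) (D.lDeltaTheta l) (PiYdd C))
          (h1LimKummerOn (phi C) (D.lDeltaTheta l) (PiYdd C) c hA hfi O) iota).thetaMonoid (K.label α)).subtype).codRestrict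
            (MonoidHom.mrange (h1LimKummerOn φ₀ (D.lDeltaTheta l) ⊤ c₀ hA₀ hfi₀ O))
            (restriction_mem_mrange_gen
              ((thetaEnvData C hC hS hl hp2 hpl hζ mods f hf hmods h15 L hZ hcharY hlim).toRecord
          (h1LimConjMulAut (phi C) (D.lDeltaTheta l) (PiYdd C))
          (h1LimKummerOn (phi C) (D.lDeltaTheta l) (PiYdd C) c hA hfi O) iota)
              (h1LimKummerOn (phi C) (D.lDeltaTheta l) (PiYdd C) c hA hfi O)
              (h1LimKummerOn φ₀ (D.lDeltaTheta l) ⊤ c₀ hA₀ hfi₀ O)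
              (fun t => (R t).comp (((thetaEnvData C hC hS hl hp2 hpl hζ mods f hf hmods h15 L hZ hcharY hlim).toRecord
          (h1LimConjMulAut (phi C) (D.lDeltaTheta l) (PiYdd C))
          (h1LimKummerOn (phi C) (D.lDeltaTheta l) (PiYdd C) c hA hfi O) iota).thetaMonoid (K.label α)).subtype)
              q (hκ_padic C c hA hfi O hc) (ThetaEnvData.toRecord_constantMonoid _ _ _ _) hθ
              (horb_toRecord_pairRhoLim C hC hS hl hp2 hpl hζ mods f hf hmods h15 L hZ hcharY hlim
                iota c hA hfi O hc hOtors αι βι hφαβ hAβ hH γ ε hγ hε₁ hε₂ hαγ hsign hroot hfree hker hi₀ hθ)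
              (fun t m hm => hRκ_toRecord C hC hS hl hp2 hpl hζ mods f hf hmods h15 L hZ hcharY hlim iota φ₀ s hι hN hφ c
                hA hfi O c₀ hA₀ hfi₀ hc₀c hact R hR t m hm)
              (fun t => hRθ_toRecord_of_evaluation C hC hS hl hp2 hpl hζ mods f hf hmods h15 L hZ hcharY hlim iota φ₀ s hι hN
                hφ c hA hfi O c₀ hA₀ hfi₀ cf hAf hfif R hR ev hev hcev hθf q hval t) t)) t
            ⟨θ, thetaEnv_subset_thetaMonoid
              ((thetaEnvData C hC hS hl hp2 hpl hζ mods f hf hmods h15 L hZ hcharY hlim).toRecord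
          (h1LimConjMulAut (phi C) (D.lDeltaTheta l) (PiYdd C))
          (h1LimKummerOn (phi C) (D.lDeltaTheta l) (PiYdd C) c hA hfi O) iota) (K.label α) hθ⟩)),
      (∀ m : O, ((e m : MonoidHom.mrange (h1LimKummerOn φ₀ (D.lDeltaTheta l) ⊤ c₀ hA₀ hfi₀ O)) :
          Multiplicative (h1Lim φ₀ (D.lDeltaTheta l) (⊤ : Subgroup P₀) ⊥)) = (h1LimKummerOn φ₀ (D.lDeltaTheta l) ⊤ c₀ hA₀ hfi₀ O) m) ∧
      ∀ x, piIso Lbl e ((Φ x : frobenioidGaussianMonoid e _) : Lbl → O) =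
        MonoidHom.pi
          (fun t =>
          ((R t).comp (((thetaEnvData C hC hS hl hp2 hpl hζ mods f hf hmods h15 L hZ hcharY hlim).toRecord
          (h1LimConjMulAut (phi C) (D.lDeltaTheta l) (PiYdd C))
          (h1LimKummerOn (phi C) (D.lDeltaTheta l) (PiYdd C) c hA hfi O) iota).thetaMonoid (K.label α)).subtype).codRestrict
            (MonoidHom.mrange (h1LimKummerOn φ₀ (D.lDeltaTheta l) ⊤ c₀ hA₀ hfi₀ O))
            (restriction_mem_mrange_gen
              ((thetaEnvData C hC hS hl hp2 hpl hζ mods f hf hmods h15 L hZ hcharY hlim).toRecord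
          (h1LimConjMulAut (phi C) (D.lDeltaTheta l) (PiYdd C))
          (h1LimKummerOn (phi C) (D.lDeltaTheta l) (PiYdd C) c hA hfi O) iota)
              (h1LimKummerOn (phi C) (D.lDeltaTheta l) (PiYdd C) c hA hfi O)
              (h1LimKummerOn φ₀ (D.lDeltaTheta l) ⊤ c₀ hA₀ hfi₀ O)
              (fun t => (R t).comp (((thetaEnvData C hC hS hl hp2 hpl hζ mods f hf hmods h15 L hZ hcharY hlim).toRecord
          (h1LimConjMulAut (phi C) (D.lDeltaTheta l) (PiYdd C))
          (h1LimKummerOn (phi C) (D.lDeltaTheta l) (PiYdd C) c hA hfi O) iota).thetaMonoid (K.label α)).subtype)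
              q (hκ_padic C c hA hfi O hc) (ThetaEnvData.toRecord_constantMonoid _ _ _ _) hθ
              (horb_toRecord_pairRhoLim C hC hS hl hp2 hpl hζ mods f hf hmods h15 L hZ hcharY hlim
                iota c hA hfi O hc hOtors αι βι hφαβ hAβ hH γ ε hγ hε₁ hε₂ hαγ hsign hroot hfree hker hi₀ hθ)
              (fun t m hm => hRκ_toRecord C hC hS hl hp2 hpl hζ mods f hf hmods h15 L hZ hcharY hlim iota φ₀ s hι hN hφ c
                hA hfi O c₀ hA₀ hfi₀ hc₀c hact R hR t m hm)
              (fun t => hRθ_toRecord_of_evaluation C hC hS hl hp2 hpl hζ mods f hf hmods h15 L hZ hcharY hlim iota φ₀ s hι hN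
                hφ c hA hfi O c₀ hA₀ hfi₀ cf hAf hfif R hR ev hev hcev hθf q hval t) t))
          (K.kummerTheta α x) := by
  have hκ₀ : Function.Injective (h1LimKummerOn φ₀ (D.lDeltaTheta l) ⊤ c₀ hA₀ hfi₀ O) :=
    hκ₀_padic (C := C) (O := O) (φ₀ := φ₀) (s := s) (hι := hι) (c₀ := c₀) (hA₀ := hA₀) (hfi₀ := hfi₀) hc₀ t₁ (hact t₁)
  let e : O ≃* MonoidHom.mrange (h1LimKummerOn φ₀ (D.lDeltaTheta l) ⊤ c₀ hA₀ hfi₀ O) :=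
    MulEquiv.ofBijective (h1LimKummerOn φ₀ (D.lDeltaTheta l) ⊤ c₀ hA₀ hfi₀ O).mrangeRestrict
      ⟨fun _ _ h => hκ₀ (congrArg Subtype.val h), (h1LimKummerOn φ₀ (D.lDeltaTheta l) ⊤ c₀ hA₀ hfi₀ O).mrangeRestrict_surjective⟩
  obtain ⟨Φ, hΦ⟩ :=
    exists_kummerRestrictionTransportIso'_toRecord_padic_of_evaluation_pairRhoLim C hC hS hl hp2 hpl hζ mods f hf hmods h15 L hZ
      hcharY hlim iota φ₀ s hι hN hφ c hA hfi O c₀ hA₀ hfi₀ cf hAf hfif hc hOtors αι βι hφαβ hAβ hH γ ε hγ hε₁ hε₂ hαγ hsign hroot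
      hfree hker hc₀ hc₀c hact t₁ K α hθ hi₀ R hR ev hev hcev hθf q hval t₀ hq e
  exact ⟨e, Φ, fun _ => rfl, hΦ⟩

end Padic

end EtaleLevels

end Literature.IUT.HodgeArakelov

end
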